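/-
VALUE = THEOREM, NOT summit progress (cell b2b-lgcu-borel, gen 21); crux 14079 untouched.
-/
import Mathlib
import Summits.MatrixMultiplication.MatrixMultiplication.Theorems.SubgroupIdentityDesigns.Negative.GLmLevelOneCertificates
import Summits.MatrixMultiplication.MatrixMultiplication.Theorems.SubgroupIdentityDesigns.Negative.CornerSums

/-!
# Root-chain exclusion: three root groups of a unitriangular `U₃`, one per member

VALUE = THEOREM (valid for every prime `p`, every `m ≥ 3`, every `ε`), NOT summit progress.

Fix distinct indices `i, j, k` and the copy `U = {u(x,y,z) = 1 + x E_{ij} + y E_{ik} + z E_{jk}}`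
of the `3 × 3` unitriangular group inside `GL_m(𝔽_p)` (order `p³`).  The linear character
`χ(u(x,y,z)) = ψ(x + z)` of `U` is NON-TRIVIAL ON EVERY VECTOR STABILISER `Stab_U(a)`,
`a ∈ 𝔽_p^m` (`stab_sum`): if `a_k ≠ 0` the stabiliser is `{u(x, -x a_j/a_k, 0)}` (`χ = ψ(x)`),
if `a_k = 0 ≠ a_j` it is `{u(0,y,z)}` (`χ = ψ(z)`), otherwise it is `U`.  So `(U, χ)` is a
CHARACTER CERTIFICATE in the sense of `GLmLevelOneCertificates.no_levelOne_design_of_character_gl`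
(gen ≤ 20): whenever `U ∖ 1 ⊆ H₁ H₂ H₃` (as triple products), the triple `(H₁, H₂, H₃)` carries
no level-one identity design (`no_design_of_cover`) — no TPP and no volume hypothesis needed.

The point of this file is that the covering `U ∖ 1 ⊆ H₁ H₂ H₃` holds as soon as the three ROOT
GROUPS `X_{ij} = {u(x,0,0)}`, `X_{ik} = {u(0,y,0)}`, `X_{jk} = {u(0,0,z)}` (order `p` each; for
`p` prime a root group is generated by a single transvection) sit ONE IN EACH MEMBER, in any of
the six assignments (`U = X_α X_β X_γ` for every ordering of its roots; `cover₁₂₃`, `cover₃₂₁`,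
`cover₁₃₂`): **no subgroup triple carrying a level-one identity design has transvections
`t₁ ∈ H_a`, `t₂ ∈ H_b`, `t₃ ∈ H_c` (`{a,b,c} = {1,2,3}`) forming a unitriangular frame**
(`centre t₁ = centre t₂`, `axis t₂ = axis t₃`, `centre t₃ ∉ axis t₁`; such a triple is
simultaneously conjugate to `E_{ij}, E_{ik}, E_{jk}`; the coordinate case is proved here).
Single members (`U ≤ H₁`, gen 2) and pairs (`X_{ij} X_{ik} ≤ H₁`, `X_{jk} ≤ H₃`, …) are special
cases of the cover hypothesis.  Two root groups alone never suffice (the product set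
`X_{ij} X_{jk}` carries `δ₁` at level one; rank computation `work/rootchain_check.py`).

Mechanism, compared with the rest of the directory: the admissibility principle and the
product obstruction use linear characters of MEMBERS; here the certificate subgroup `U` is
spread ACROSS the members, which the coset-certificate engine allows because it only needs the
product SET `H₁ H₂ H₃` to contain `U ∖ 1`.  Dually (restriction to `U = 1 + 𝒩`, `𝒩` the strictly
upper `3 × 3` corner): level-one functions restricted to `1 + 𝒩` are spanned by the additive
characters `N ↦ ψ(tr(M N))` with `rk M ≤ 1`, and the `(p-1)²` functionals
`N ↦ α N_{ij} + γ N_{jk}` (`αγ ≠ 0`) have no rank-`≤ 1` representative, so `δ₁|_U` is not a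
level-one restriction (numerically: `rk F₁|_U = p³ - (p-1)²` for `p = 2, 3, 5`).

HONEST SCOPE.  Excludes member configurations; no `(p,m,ε)` cell is emptied.
-/

set_option linter.dupNamespace false

noncomputable section

open scoped BigOperators Matrix Classical
open Summit.MatrixMultiplication.MatrixMultiplication.Theorems.LieRankDesigns.Negative (GLm Mat)

namespace Summit.MatrixMultiplication.MatrixMultiplication.Theorems.SubgroupIdentityDesigns.Negative
namespace RootChain

variable {p m : ℕ}

/-! ## The unitriangular elements `u(x,y,z)` -/

section Elements

variable {i j k : Fin m}

/-- `u(x,y,z) = 1 + x E_{ij} + y E_{ik} + z E_{jk}` as a matrix. -/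
def umat (i j k : Fin m) (x y z : ZMod p) : Mat p m :=
  1 + Matrix.single i j x + Matrix.single i k y + Matrix.single j k z

/-- `u(0,0,0) = 1`. -/
theorem umat_zero : umat i j k (0 : ZMod p) 0 0 = 1 := by
  simp [umat]

/-- The Heisenberg multiplication `u(x,y,z) u(x',y',z') = u(x+x', y+y'+xz', z+z')`. -/
theorem umat_mul (hij : i ≠ j) (hik : i ≠ k) (hjk : j ≠ k) (x y z x' y' z' : ZMod p) :
    umat i j k x y z * umat i j k x' y' z' = umat i j k (x + x') (y + y' + x * z') (z + z') := by
  simp only [umat, Matrix.single_add, mul_add, add_mul, one_mul, mul_one,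
    Matrix.single_mul_single_same, ne_eq, hij.symm, hik.symm, hjk.symm, not_false_eq_true,
    Matrix.single_mul_single_of_ne, add_zero]
  abel

/-- The entry `(i,j)` of `u(x,y,z)` is `x`. -/
theorem umat_apply_ij (hij : i ≠ j) (hjk : j ≠ k) (x y z : ZMod p) :
    umat i j k x y z i j = x := by
  simp [umat, hij, hjk.symm, hij.symm]

/-- The entry `(i,k)` of `u(x,y,z)` is `y`. -/
theorem umat_apply_ik (hij : i ≠ j) (hik : i ≠ k) (hjk : j ≠ k) (x y z : ZMod p) :
    umat i j k x y z i k = y := by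
  simp [umat, hik, hjk, hij.symm]

/-- The entry `(j,k)` of `u(x,y,z)` is `z`. -/
theorem umat_apply_jk (hij : i ≠ j) (hjk : j ≠ k) (x y z : ZMod p) :
    umat i j k x y z j k = z := by
  simp [umat, hjk, hij]

/-- `u(x,y,z) a = a + (x a_j + y a_k) e_i + (z a_k) e_j`. -/
theorem umat_mulVec (x y z : ZMod p) (a : Fin m → ZMod p) :
    umat i j k x y z *ᵥ a =
      a + ((x * a j + y * a k) • Pi.single i 1 + (z * a k) • Pi.single j 1) := by
  simp only [umat, Matrix.add_mulVec, Matrix.one_mulVec, Matrix.single_mulVec_eq, add_smul]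
  abel

/-- `u(x,y,z)` fixes `a` iff `x a_j + y a_k = 0` and `z a_k = 0`. -/
theorem umat_mulVec_eq_iff (hij : i ≠ j) (x y z : ZMod p) (a : Fin m → ZMod p) :
    umat i j k x y z *ᵥ a = a ↔ x * a j + y * a k = 0 ∧ z * a k = 0 := by
  rw [umat_mulVec, add_eq_left]
  constructor
  · intro h
    have hi := congr_fun h i
    have hj := congr_fun h j
    simp only [Pi.add_apply, Pi.smul_apply, Pi.single_apply, if_true, if_neg hij,
      if_neg hij.symm, smul_eq_mul, mul_one, mul_zero, add_zero, zero_add, Pi.zero_apply] at hi hj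
    exact ⟨hi, hj⟩
  · rintro ⟨h₁, h₂⟩
    rw [h₁, h₂, zero_smul, zero_smul, add_zero]

variable (hij : i ≠ j) (hik : i ≠ k) (hjk : j ≠ k)
include hij hik hjk

/-- `u(x,y,z)` as an element of `GL_m(𝔽_p)` (inverse `u(-x, xz-y, -z)`). -/
def uGL (x y z : ZMod p) : GLm p m :=
  ⟨umat i j k x y z, umat i j k (-x) (x * z - y) (-z),
    by rw [umat_mul hij hik hjk]; convert umat_zero using 2 <;> ring,
    by rw [umat_mul hij hik hjk]; convert umat_zero using 2 <;> ring⟩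

/-- The matrix of `uGL`. -/
theorem coe_uGL (x y z : ZMod p) :
    ((uGL hij hik hjk x y z : GLm p m) : Mat p m) = umat i j k x y z := rfl

/-- `uGL 0 0 0 = 1`. -/
theorem uGL_zero : uGL hij hik hjk (0 : ZMod p) 0 0 = 1 :=
  Units.ext umat_zero

/-- Multiplication of the `uGL`. -/
theorem uGL_mul (x y z x' y' z' : ZMod p) :
    uGL hij hik hjk x y z * uGL hij hik hjk x' y' z' =
      uGL hij hik hjk (x + x') (y + y' + x * z') (z + z') :=
  Units.ext (umat_mul hij hik hjk x y z x' y' z')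

/-! ## The certificate subgroup `U` and its character `χ` -/

/-- `U = {u(x,y,z)}`, a copy of the `3 × 3` unitriangular group (order `p³`). -/
def U : Subgroup (GLm p m) where
  carrier := {g | ∃ x y z : ZMod p, g = uGL hij hik hjk x y z}
  one_mem' := ⟨0, 0, 0, (uGL_zero hij hik hjk).symm⟩
  mul_mem' := by
    rintro _ _ ⟨x, y, z, rfl⟩ ⟨x', y', z', rfl⟩
    exact ⟨_, _, _, uGL_mul hij hik hjk x y z x' y' z'⟩
  inv_mem' := by
    rintro _ ⟨x, y, z, rfl⟩
    exact ⟨-x, x * z - y, -z, Units.ext rfl⟩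

/-- The parametrisation `𝔽_p³ ≃ U`, `(x,y,z) ↦ u(x,y,z)` (entries `(i,j), (i,k), (j,k)` back). -/
def param : ZMod p × ZMod p × ZMod p ≃ U (p := p) hij hik hjk where
  toFun t := ⟨uGL hij hik hjk t.1 t.2.1 t.2.2, t.1, t.2.1, t.2.2, rfl⟩
  invFun s := (((s : GLm p m) : Mat p m) i j, ((s : GLm p m) : Mat p m) i k,
    ((s : GLm p m) : Mat p m) j k)
  left_inv := fun ⟨x, y, z⟩ => by
    show ((umat i j k x y z) i j, (umat i j k x y z) i k, (umat i j k x y z) j k) = (x, y, z)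
    rw [umat_apply_ij hij hjk, umat_apply_ik hij hik hjk, umat_apply_jk hij hjk]
  right_inv s := by
    obtain ⟨x, y, z, hs⟩ := s.2
    apply Subtype.ext
    show uGL hij hik hjk (((s : GLm p m) : Mat p m) i j) (((s : GLm p m) : Mat p m) i k)
      (((s : GLm p m) : Mat p m) j k) = (s : GLm p m)
    rw [hs, coe_uGL, umat_apply_ij hij hjk, umat_apply_ik hij hik hjk, umat_apply_jk hij hjk]

/-- The matrix of `param t`. -/
theorem coe_param (t : ZMod p × ZMod p × ZMod p) :
    ((param hij hik hjk t : U (p := p) hij hik hjk) : GLm p m) =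
      uGL hij hik hjk t.1 t.2.1 t.2.2 := rfl

end Elements

/-! ## The certificate character `χ` -/

section Character

variable [hp : Fact p.Prime] {i j k : Fin m}

/-- The certificate character `χ(g) = ψ(g_{ij} + g_{jk})` (a function on all of `GL_m`). -/
def chi (i j k : Fin m) (g : GLm p m) : ℂ :=
  ZMod.stdAddChar (((g : GLm p m) : Mat p m) i j + ((g : GLm p m) : Mat p m) j k)

variable (hij : i ≠ j) (hik : i ≠ k) (hjk : j ≠ k)
include hij hik hjk

/-- `χ(u(x,y,z)) = ψ(x + z)`. -/
theorem chi_uGL (x y z : ZMod p) :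
    chi i j k (uGL hij hik hjk x y z) = ZMod.stdAddChar (x + z) := by
  rw [chi, coe_uGL, umat_apply_ij hij hjk, umat_apply_jk hij hjk]

omit hik in
/-- `χ(1) = 1`. -/
theorem chi_one : chi i j k (1 : GLm p m) = 1 := by
  simp [chi, hij, hjk]

/-- `χ` is multiplicative on `U`. -/
theorem chi_mul : ∀ g ∈ U (p := p) hij hik hjk, ∀ s ∈ U hij hik hjk,
    chi i j k (g * s) = chi i j k g * chi i j k s := by
  rintro _ ⟨x, y, z, rfl⟩ _ ⟨x', y', z', rfl⟩
  rw [uGL_mul, chi_uGL, chi_uGL, chi_uGL, ← AddChar.map_add_eq_mul]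
  congr 1
  ring

end Character

/-! ## `χ` is non-trivial on every vector stabiliser -/

section Stabilisers

variable [hp : Fact p.Prime] {i j k : Fin m} (hij : i ≠ j) (hik : i ≠ k) (hjk : j ≠ k)
include hij hik hjk

omit hij hik hjk in
/-- `Σ_z ψ(x + z) = 0`. -/
theorem sum_psi_add (x : ZMod p) : ∑ z : ZMod p, (ZMod.stdAddChar (x + z) : ℂ) = 0 := by
  simp_rw [AddChar.map_add_eq_mul]
  rw [← Finset.mul_sum]
  have h := sum_psi_mul_right (p := p) 1
  simp_rw [mul_one] at h
  rw [h, if_neg one_ne_zero, mul_zero]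

/-- **The stabiliser sums vanish**: `Σ_{s ∈ U, s a = a} χ(s) = 0` for every vector `a`. -/
theorem stab_sum (a : Fin m → ZMod p) :
    (∑ s : U (p := p) hij hik hjk,
      if ((s : GLm p m) : Mat p m) *ᵥ a = a then chi i j k (s : GLm p m) else 0) = 0 := by
  rw [← (param hij hik hjk).sum_comp]
  simp only [coe_param, coe_uGL, chi_uGL, umat_mulVec_eq_iff hij]
  rw [Fintype.sum_prod_type]
  simp_rw [Fintype.sum_prod_type]
  -- goal: Σ_x Σ_y Σ_z [x a_j + y a_k = 0 ∧ z a_k = 0] ψ(x + z) = 0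
  by_cases hk : a k = 0
  · refine Finset.sum_eq_zero fun x _ => ?_
    by_cases hx : x * a j = 0
    · -- the condition holds for every `y, z`: inner sum `Σ_z ψ(x+z) = 0`
      simp only [hk, mul_zero, add_zero, hx, true_and, if_true, sum_psi_add,
        Finset.sum_const_zero]
    · simp only [hk, mul_zero, add_zero, hx, false_and, if_false, Finset.sum_const_zero]
  · -- `a_k ≠ 0`: `z = 0` and `y = -x a_j / a_k` are forced; the sum is `Σ_x ψ(x) = 0`
    have hinner : ∀ x : ZMod p, (∑ y : ZMod p, ∑ z : ZMod p,
        if x * a j + y * a k = 0 ∧ z * a k = 0 then (ZMod.stdAddChar (x + z) : ℂ) else 0) =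
        ZMod.stdAddChar x := by
      intro x
      have hz : ∀ y : ZMod p, (∑ z : ZMod p,
          if x * a j + y * a k = 0 ∧ z * a k = 0 then (ZMod.stdAddChar (x + z) : ℂ) else 0) =
          if x * a j + y * a k = 0 then (ZMod.stdAddChar x : ℂ) else 0 := by
        intro y
        rw [Finset.sum_eq_single (0 : ZMod p)]
        · simp only [zero_mul, add_zero, and_true]
        · intro z _ hz
          rw [if_neg]
          rintro ⟨-, h⟩
          exact hz ((mul_eq_zero.1 h).resolve_right hk)
        · exact fun h => (h (Finset.mem_univ _)).elim
      simp_rw [hz]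
      rw [Finset.sum_eq_single (-(x * a j) * (a k)⁻¹)]
      · rw [if_pos]
        rw [neg_mul, neg_mul, inv_mul_cancel_right₀ hk, add_neg_cancel]
      · intro y _ hy
        rw [if_neg]
        intro h
        apply hy
        rw [eq_mul_inv_iff_mul_eq₀ hk]
        linear_combination h
      · exact fun h => (h (Finset.mem_univ _)).elim
    simp_rw [hinner]
    have h := sum_psi_mul_right (p := p) 1
    simp_rw [mul_one] at h
    rw [h, if_neg one_ne_zero]

end Stabilisers

/-! ## The exclusions -/

section Exclusion

variable [hp : Fact p.Prime] {i j k : Fin m} (hij : i ≠ j) (hik : i ≠ k) (hjk : j ≠ k)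
  {H₁ H₂ H₃ : Subgroup (GLm p m)}
include hij hik hjk

/-- **`U`-CERTIFICATE EXCLUSION**: if every `u(x,y,z) ≠ 1` is a triple product `a b g`,
`a ∈ H₁, b ∈ H₂, g ∈ H₃`, then `(H₁, H₂, H₃)` carries no level-one identity design. -/
theorem no_design_of_cover
    (hcov : ∀ g ∈ U (p := p) hij hik hjk, g ≠ 1 → ∃ a ∈ H₁, ∃ b ∈ H₂, ∃ c ∈ H₃, a * b * c = g) :
    ¬ ∃ c : Mat p m → ℂ, (∀ M, 1 < M.rank → c M = 0) ∧
      (∑ M, c M * ZMod.stdAddChar (Matrix.trace (M * ((1 : GLm p m) : Mat p m)))) = 1 ∧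
      ∀ a ∈ H₁, ∀ b ∈ H₂, ∀ g ∈ H₃, a * b * g ≠ 1 →
        (∑ M, c M * ZMod.stdAddChar (Matrix.trace (M * ((a * b * g : GLm p m) : Mat p m)))) = 0 := by
  haveI : NeZero m := NeZero.of_pos (Fin.pos i)
  refine no_levelOne_design_of_character_gl (U hij hik hjk) (chi i j k) ?_ (chi_mul hij hik hjk)
    (fun a _ => stab_sum hij hik hjk a) hcov
  rw [chi_one hij hjk]
  exact one_ne_zero

/-- The cover from the assignment `X_{ij} ≤ H₁`, `X_{ik} ≤ H₂`, `X_{jk} ≤ H₃`: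
`u(x,y,z) = u(x,0,0) u(0,y-xz,0) u(0,0,z)`. -/
theorem cover₁₂₃ (h₁ : ∀ x, uGL hij hik hjk x 0 0 ∈ H₁) (h₂ : ∀ y, uGL hij hik hjk 0 y 0 ∈ H₂)
    (h₃ : ∀ z, uGL hij hik hjk 0 0 z ∈ H₃) :
    ∀ g ∈ U (p := p) hij hik hjk, g ≠ 1 → ∃ a ∈ H₁, ∃ b ∈ H₂, ∃ c ∈ H₃, a * b * c = g := by
  rintro _ ⟨x, y, z, rfl⟩ _
  refine ⟨_, h₁ x, _, h₂ (y - x * z), _, h₃ z, ?_⟩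
  rw [uGL_mul, uGL_mul]
  congr 1 <;> ring

/-- The cover from the reversed assignment `X_{jk} ≤ H₁`, `X_{ik} ≤ H₂`, `X_{ij} ≤ H₃`:
`u(x,y,z) = u(0,0,z) u(0,y,0) u(x,0,0)`. -/
theorem cover₃₂₁ (h₁ : ∀ z, uGL hij hik hjk 0 0 z ∈ H₁) (h₂ : ∀ y, uGL hij hik hjk 0 y 0 ∈ H₂)
    (h₃ : ∀ x, uGL hij hik hjk x 0 0 ∈ H₃) :
    ∀ g ∈ U (p := p) hij hik hjk, g ≠ 1 → ∃ a ∈ H₁, ∃ b ∈ H₂, ∃ c ∈ H₃, a * b * c = g := by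
  rintro _ ⟨x, y, z, rfl⟩ _
  refine ⟨_, h₁ z, _, h₂ y, _, h₃ x, ?_⟩
  rw [uGL_mul, uGL_mul]
  congr 1 <;> ring

/-- The cover from the assignment `X_{ij} ≤ H₁`, `X_{jk} ≤ H₂`, `X_{ik} ≤ H₃`:
`u(x,y,z) = u(x,0,0) u(0,0,z) u(0,y-xz,0)`. -/
theorem cover₁₃₂ (h₁ : ∀ x, uGL hij hik hjk x 0 0 ∈ H₁) (h₂ : ∀ z, uGL hij hik hjk 0 0 z ∈ H₂)
    (h₃ : ∀ y, uGL hij hik hjk 0 y 0 ∈ H₃) :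
    ∀ g ∈ U (p := p) hij hik hjk, g ≠ 1 → ∃ a ∈ H₁, ∃ b ∈ H₂, ∃ c ∈ H₃, a * b * c = g := by
  rintro _ ⟨x, y, z, rfl⟩ _
  refine ⟨_, h₁ x, _, h₂ z, _, h₃ (y - x * z), ?_⟩
  rw [uGL_mul, uGL_mul]
  congr 1 <;> ring

/-- **ROOT-CHAIN EXCLUSION** (`m ≥ 3`, all `p`): root groups `X_{ij} ≤ H₁`, `X_{ik} ≤ H₂`,
`X_{jk} ≤ H₃` exclude a level-one identity design on `(H₁, H₂, H₃)`. -/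
theorem no_design_of_rootChain₁₂₃ (h₁ : ∀ x, uGL hij hik hjk x 0 0 ∈ H₁)
    (h₂ : ∀ y, uGL hij hik hjk 0 y 0 ∈ H₂) (h₃ : ∀ z, uGL hij hik hjk 0 0 z ∈ H₃) :
    ¬ ∃ c : Mat p m → ℂ, (∀ M, 1 < M.rank → c M = 0) ∧
      (∑ M, c M * ZMod.stdAddChar (Matrix.trace (M * ((1 : GLm p m) : Mat p m)))) = 1 ∧
      ∀ a ∈ H₁, ∀ b ∈ H₂, ∀ g ∈ H₃, a * b * g ≠ 1 →
        (∑ M, c M * ZMod.stdAddChar (Matrix.trace (M * ((a * b * g : GLm p m) : Mat p m)))) = 0 :=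
  no_design_of_cover hij hik hjk (cover₁₂₃ hij hik hjk h₁ h₂ h₃)

/-- **ROOT-CHAIN EXCLUSION, reversed**: `X_{jk} ≤ H₁`, `X_{ik} ≤ H₂`, `X_{ij} ≤ H₃`. -/
theorem no_design_of_rootChain₃₂₁ (h₁ : ∀ z, uGL hij hik hjk 0 0 z ∈ H₁)
    (h₂ : ∀ y, uGL hij hik hjk 0 y 0 ∈ H₂) (h₃ : ∀ x, uGL hij hik hjk x 0 0 ∈ H₃) :
    ¬ ∃ c : Mat p m → ℂ, (∀ M, 1 < M.rank → c M = 0) ∧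
      (∑ M, c M * ZMod.stdAddChar (Matrix.trace (M * ((1 : GLm p m) : Mat p m)))) = 1 ∧
      ∀ a ∈ H₁, ∀ b ∈ H₂, ∀ g ∈ H₃, a * b * g ≠ 1 →
        (∑ M, c M * ZMod.stdAddChar (Matrix.trace (M * ((a * b * g : GLm p m) : Mat p m)))) = 0 :=
  no_design_of_cover hij hik hjk (cover₃₂₁ hij hik hjk h₁ h₂ h₃)

/-- **ROOT-CHAIN EXCLUSION, mixed**: `X_{ij} ≤ H₁`, `X_{jk} ≤ H₂`, `X_{ik} ≤ H₃`. -/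
theorem no_design_of_rootChain₁₃₂ (h₁ : ∀ x, uGL hij hik hjk x 0 0 ∈ H₁)
    (h₂ : ∀ z, uGL hij hik hjk 0 0 z ∈ H₂) (h₃ : ∀ y, uGL hij hik hjk 0 y 0 ∈ H₃) :
    ¬ ∃ c : Mat p m → ℂ, (∀ M, 1 < M.rank → c M = 0) ∧
      (∑ M, c M * ZMod.stdAddChar (Matrix.trace (M * ((1 : GLm p m) : Mat p m)))) = 1 ∧
      ∀ a ∈ H₁, ∀ b ∈ H₂, ∀ g ∈ H₃, a * b * g ≠ 1 →
        (∑ M, c M * ZMod.stdAddChar (Matrix.trace (M * ((a * b * g : GLm p m) : Mat p m)))) = 0 :=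
  no_design_of_cover hij hik hjk (cover₁₃₂ hij hik hjk h₁ h₂ h₃)

end Exclusion

end RootChain
end Summit.MatrixMultiplication.MatrixMultiplication.Theorems.SubgroupIdentityDesigns.Negative
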